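import Mathlib
import Summits.MatrixMultiplication.MatrixMultiplication.Theorems.LevelGradedCohnUmansLevelOneGL2DesignsStubTangencySetsHermitianRankThree

/-!
# Stub `stub_tangencySets` (crux `LevelOneGL2Designs`, stmt-MatrixMultiplication-14080) —
wall-breaker axis 1/12 "Hermitian unital constructions" (gen 1, seat 3): door D9, CONJUGATION RULES

In the rank-three normal form of part C (`…StubTangencySetsHermitianRankThree`:
`T(p) + O(1) = max {n : ∃ E ∈ M_n(𝔽_p), rank E ≤ 3, E_ii = 0, E_ij ≠ 0 (i ≠ j)}`) the unital is the
`q³+1`-row solution over `𝔽_{q²}` organised by the CONJUGATION RULE `E_ji = (E_ij)^q`.  A prime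
field has no Frobenius; its symmetric avatar `E_ji = E_ij` is capped at `p+1` (Baer, part A). 
Which other entrywise rules `R(E_ij, E_ji) = 0` could organise a design?  Answer for every rule of
bidegree `≤ (1,1)`, `α·E_ij E_ji + β·E_ij + γ·E_ji + δ = 0` (`i ≠ j`) — sum rules, product rules,
Möbius rules `E_ji = (aE_ij+b)/(cE_ij+d)`:
* `card_le_of_bilinear_rule`: a rule missing the origin (`δ ≠ 0`) forces `n ≤ 16` over ANY field,
  even without `E_ij ≠ 0` (`δ·1 = −(α·E∘Eᵀ + β·E + γ·Eᵀ) + δ·J` has rank `≤ 9+3+3+1`: the Hadamard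
  product `E ∘ Eᵀ` factors through `F⁹`, `hadamardTranspose_eq_mul`); `n ≤ 7` for sum rules, `n ≤
  10` for product rules (`card_le_of_sum_rule`, `card_le_of_prod_rule`, `card_le_of_moebius_rule`);
* `card_le_of_skew_rule`: the skew rule `E_ji = −E_ij` allows at most `|F| + 3` rows (an alternating
  matrix of rank `≤ 3` satisfies the `4 × 4` Pfaffian relations, `pfaffian_eq_zero`, so its rows are
  pairwise non-proportional points of a projective LINE; `E_ij = a_i − a_j` attains `|F|`);
* stub format (`srs_card_le_of_bilinear_rule`, `srs_card_le_of_skew_rule`) and the registered stub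
  `not_bilinearRule_tangencySets`: the rule-conjugate form of `stub_tangencySets` is FALSE
  outright, like the polar form (`BaerPolarity.not_polar_tangencySets`).
Up to scaling the bidegree-(1,1) rules through the origin compatible with `E_ij ≠ 0` are `y = x` (≤
p+1), `y = −x` (≤ p+3) and `(x−1)(y−1) = 1` (`E_ij = 1 − x_i/x_j` gives p−1): no such rule
organises more than `p + O(1)` flags over a prime field.  Elementary linear algebra (`Matrix.rank`,
`Fintype.not_linearIndependent_iff`); no new definitions.
-/

set_option linter.dupNamespace false

namespace Summit.MatrixMultiplication.MatrixMultiplication.Theorems.LevelOneGL2Designs.ConjugationRules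

open Finset Matrix

section RankTools

variable {F : Type*} [Field F] {ι : Type*}

/-- **The Hadamard product `E ∘ Eᵀ` of a rank-three matrix with its transpose factors through `F⁹`:**
`(L i ⬝ P j)(L j ⬝ P i) = Σ_{s,t} (L i s · P i t)(P j s · L j t)`. [elementary] -/
theorem hadamardTranspose_eq_mul (L P : ι → Fin 3 → F) :
    (Matrix.of fun i j => (L i ⬝ᵥ P j) * (L j ⬝ᵥ P i)) =
      (Matrix.of fun i (st : Fin 3 × Fin 3) => L i st.1 * P i st.2) *
        (Matrix.of fun (st : Fin 3 × Fin 3) j => P j st.1 * L j st.2) := by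
  ext i j
  simp only [of_apply, Matrix.mul_apply, dotProduct, Fintype.sum_prod_type, Finset.sum_mul_sum]
  refine Finset.sum_congr rfl fun s _ => Finset.sum_congr rfl fun t _ => ?_
  ring

variable [Fintype ι]

/-- Sub-additivity of matrix rank over a field. [folklore] -/
theorem rank_add_le {κ : Type*} [Fintype κ] (A B : Matrix κ ι F) :
    (A + B).rank ≤ A.rank + B.rank := by
  unfold Matrix.rank
  rw [Matrix.mulVecLin_add]
  exact (Submodule.finrank_mono (LinearMap.range_add_le _ _)).trans
    (Submodule.finrank_add_le_finrank_add_finrank _ _)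

/-- Scaling does not raise the rank. [folklore] -/
theorem rank_smul_le {κ : Type*} [Fintype κ] (c : F) (A : Matrix κ ι F) :
    (c • A).rank ≤ A.rank := by
  by_cases hc : c = 0
  · simp [hc]
  · have h : (c • A).mulVecLin = c • A.mulVecLin := by
      apply LinearMap.ext
      intro v
      simp
    unfold Matrix.rank
    rw [h, LinearMap.range_smul _ _ hc]

/-- A non-zero multiple of the identity has full rank. [folklore] -/
theorem rank_smul_one [DecidableEq ι] {c : F} (hc : c ≠ 0) :
    (c • (1 : Matrix ι ι F)).rank = Fintype.card ι := by
  refine le_antisymm ((rank_smul_le c _).trans (by simp)) ?_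
  have h : (1 : Matrix ι ι F) = c⁻¹ • (c • (1 : Matrix ι ι F)) := by
    rw [smul_smul, inv_mul_cancel₀ hc, one_smul]
  calc Fintype.card ι = (1 : Matrix ι ι F).rank := (rank_one).symm
    _ = (c⁻¹ • (c • (1 : Matrix ι ι F))).rank := by rw [← h]
    _ ≤ (c • (1 : Matrix ι ι F)).rank := rank_smul_le _ _

/-- The all-ones matrix has rank `≤ 1`. [folklore] -/
theorem rank_ones_le_one : (Matrix.of fun (_ : ι) (_ : ι) => (1 : F)).rank ≤ 1 := by
  have h : (Matrix.of fun (_ : ι) (_ : ι) => (1 : F)) = vecMulVec (fun _ => 1) (fun _ => 1) := by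
    ext i j
    simp [vecMulVec_apply]
  rw [h]
  exact rank_vecMulVec_le _ _

/-- The matrix of dot products `(L i ⬝ P j)` of vectors in `F³` has rank `≤ 3`. [folklore] -/
theorem rank_dotMatrix_le (L P : ι → Fin 3 → F) :
    (Matrix.of fun i j => L i ⬝ᵥ P j).rank ≤ 3 := by
  have h : (Matrix.of fun i j => L i ⬝ᵥ P j) =
      (Matrix.of fun i t => L i t) * (Matrix.of fun t j => P j t) := by
    ext i j
    simp [Matrix.mul_apply, dotProduct]
  rw [h]
  exact (rank_mul_le_left _ _).trans (rank_le_card_width _ |>.trans (by simp))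

/-- Hence `rank (E ∘ Eᵀ) ≤ 9` for `E` of rank `≤ 3` written as a dot-product matrix. [elementary] -/
theorem rank_hadamardTranspose_le (L P : ι → Fin 3 → F) :
    (Matrix.of fun i j => (L i ⬝ᵥ P j) * (L j ⬝ᵥ P i)).rank ≤ 9 := by
  rw [hadamardTranspose_eq_mul]
  exact (rank_mul_le_left _ _).trans (rank_le_card_width _ |>.trans (by simp))

end RankTools

section BilinearRules

variable {F : Type*} [Field F] [DecidableEq F] {ι : Type*} [Fintype ι] [DecidableEq ι]

/-- **Door D9, rules missing the origin.**  A square matrix `E` of rank `≤ 3` with zero diagonal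
whose mirror entries obey `α·E_ij·E_ji + β·E_ij + γ·E_ji + δ = 0` for all `i ≠ j` with `δ ≠ 0` has at
most `9·[α ≠ 0] + 3·[β ≠ 0] + 3·[γ ≠ 0] + 1 ≤ 16` rows, over ANY field and whether or not the
off-diagonal entries vanish: `δ·1 = −(α·E∘Eᵀ + β·E + γ·Eᵀ) + δ·J` has rank `≤ 9+3+3+1`. [elementary] -/
theorem card_le_of_bilinear_rule (E : Matrix ι ι F) (hE : E.rank ≤ 3) (h0 : ∀ i, E i i = 0)
    {α β γ δ : F} (hδ : δ ≠ 0)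
    (hrule : ∀ i j, i ≠ j → α * (E i j * E j i) + β * E i j + γ * E j i + δ = 0) :
    Fintype.card ι ≤ (if α = 0 then 0 else 9) + (if β = 0 then 0 else 3) +
      (if γ = 0 then 0 else 3) + 1 := by
  classical
  obtain ⟨L, P, hLP⟩ := HermitianUnital.exists_dotProduct_eq_of_rank_le_three E hE
  -- the four summands
  let H : Matrix ι ι F := Matrix.of fun i j => (L i ⬝ᵥ P j) * (L j ⬝ᵥ P i)
  let D : Matrix ι ι F := Matrix.of fun i j => L i ⬝ᵥ P j
  let J : Matrix ι ι F := Matrix.of fun (_ : ι) (_ : ι) => (1 : F)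
  have hD : D = E := by
    ext i j
    simp [D, hLP]
  have hkey : δ • (1 : Matrix ι ι F) = α • H + β • D + γ • Dᵀ + δ • J := by
    ext i j
    by_cases hij : i = j
    · subst hij
      have := h0 i
      simp [H, D, J, hLP, this]
    · have hr := hrule i j hij
      have h1 : (1 : Matrix ι ι F) i j = 0 := Matrix.one_apply_ne hij
      simp only [Matrix.smul_apply, Matrix.add_apply, Matrix.of_apply, Matrix.transpose_apply, h1,
        hLP, smul_eq_mul, H, D, J]
      linear_combination -hr
  -- rank bounds of the summands
  have hH : (α • H).rank ≤ if α = 0 then 0 else 9 := by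
    split_ifs with hα
    · simp [hα]
    · exact (rank_smul_le _ _).trans (rank_hadamardTranspose_le L P)
  have hDr : (β • D).rank ≤ if β = 0 then 0 else 3 := by
    split_ifs with hβ
    · simp [hβ]
    · exact (rank_smul_le _ _).trans (rank_dotMatrix_le L P)
  have hDt : (γ • Dᵀ).rank ≤ if γ = 0 then 0 else 3 := by
    split_ifs with hγ
    · simp [hγ]
    · refine (rank_smul_le _ _).trans ?_
      rw [rank_transpose]
      exact rank_dotMatrix_le L P
  have hJ : (δ • J).rank ≤ 1 := (rank_smul_le _ _).trans rank_ones_le_one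
  have htot : (α • H + β • D + γ • Dᵀ + δ • J).rank ≤
      (if α = 0 then 0 else 9) + (if β = 0 then 0 else 3) + (if γ = 0 then 0 else 3) + 1 :=
    calc (α • H + β • D + γ • Dᵀ + δ • J).rank
        ≤ (α • H + β • D + γ • Dᵀ).rank + (δ • J).rank := rank_add_le _ _
      _ ≤ ((α • H + β • D).rank + (γ • Dᵀ).rank) + (δ • J).rank := by
          gcongr; exact rank_add_le _ _
      _ ≤ (((α • H).rank + (β • D).rank) + (γ • Dᵀ).rank) + (δ • J).rank := by
          gcongr; exact rank_add_le _ _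
      _ ≤ _ := by gcongr
  calc Fintype.card ι = (δ • (1 : Matrix ι ι F)).rank := (rank_smul_one hδ).symm
    _ = (α • H + β • D + γ • Dᵀ + δ • J).rank := by rw [hkey]
    _ ≤ _ := htot

/-- Uniform form: any bidegree-`(1,1)` rule with non-zero constant term forces `n ≤ 16`.
[elementary] -/
theorem card_le_sixteen_of_bilinear_rule (E : Matrix ι ι F) (hE : E.rank ≤ 3) (h0 : ∀ i, E i i = 0)
    {α β γ δ : F} (hδ : δ ≠ 0)
    (hrule : ∀ i j, i ≠ j → α * (E i j * E j i) + β * E i j + γ * E j i + δ = 0) :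
    Fintype.card ι ≤ 16 := by
  refine (card_le_of_bilinear_rule E hE h0 hδ hrule).trans ?_
  split_ifs <;> norm_num

/-- Sum rules: `E_ij + E_ji = δ ≠ 0` for `i ≠ j` forces `n ≤ 7`. [elementary] -/
theorem card_le_of_sum_rule (E : Matrix ι ι F) (hE : E.rank ≤ 3) (h0 : ∀ i, E i i = 0)
    {δ : F} (hδ : δ ≠ 0) (hrule : ∀ i j, i ≠ j → E i j + E j i = δ) :
    Fintype.card ι ≤ 7 := by
  have h := card_le_of_bilinear_rule E hE h0 (α := 0) (β := -1) (γ := -1) (δ := δ) hδ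
    (fun i j hij => by have := hrule i j hij; linear_combination -this)
  norm_num at h
  omega

/-- Product rules: `E_ij · E_ji = δ ≠ 0` for `i ≠ j` forces `n ≤ 10`. [elementary] -/
theorem card_le_of_prod_rule (E : Matrix ι ι F) (hE : E.rank ≤ 3) (h0 : ∀ i, E i i = 0)
    {δ : F} (hδ : δ ≠ 0) (hrule : ∀ i j, i ≠ j → E i j * E j i = δ) :
    Fintype.card ι ≤ 10 := by
  have h := card_le_of_bilinear_rule E hE h0 (α := -1) (β := 0) (γ := 0) (δ := δ) hδ
    (fun i j hij => by have := hrule i j hij; linear_combination -this)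
  norm_num at h
  omega

/-- Möbius (fractional-linear) conjugation rules `E_ji · (c·E_ij + d) = a·E_ij + b` with `b ≠ 0`
(i.e. `E_ji = (a E_ij + b)/(c E_ij + d)` whenever the denominator is non-zero, a rule whose graph
misses the origin) force `n ≤ 16`. [elementary] -/
theorem card_le_of_moebius_rule (E : Matrix ι ι F) (hE : E.rank ≤ 3) (h0 : ∀ i, E i i = 0)
    {a b c d : F} (hb : b ≠ 0) (hrule : ∀ i j, i ≠ j → E j i * (c * E i j + d) = a * E i j + b) :
    Fintype.card ι ≤ 16 := by
  exact card_le_sixteen_of_bilinear_rule E hE h0 (α := c) (β := -a) (γ := d) (δ := -b)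
    (neg_ne_zero.mpr hb) (fun i j hij => by have := hrule i j hij; linear_combination this)

end BilinearRules

section SkewRule

variable {F : Type*} [Field F] {ι : Type*}

/-- **The `4 × 4` Pfaffian of a skew dot-product matrix of vectors in `F³` vanishes**:
`E_ab E_ij − E_ai E_bj + E_aj E_bi = 0` for `E_ij = L_i ⬝ P_j` alternating (four vectors of `F³`
are dependent, and a non-zero vector in the kernel of an alternating `4 × 4` matrix kills its
Pfaffian). [elementary] -/
theorem pfaffian_eq_zero (L P : ι → Fin 3 → F) (h0 : ∀ i, L i ⬝ᵥ P i = 0)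
    (hskew : ∀ i j, L j ⬝ᵥ P i = -(L i ⬝ᵥ P j)) (a b i j : ι) :
    (L a ⬝ᵥ P b) * (L i ⬝ᵥ P j) - (L a ⬝ᵥ P i) * (L b ⬝ᵥ P j) +
      (L a ⬝ᵥ P j) * (L b ⬝ᵥ P i) = 0 := by
  classical
  -- four vectors in `F³` are linearly dependent
  let v : Fin 4 → (Fin 3 → F) := ![L a, L b, L i, L j]
  have hdep : ¬ LinearIndependent F v := by
    intro hli
    have := hli.fintype_card_le_finrank
    simp at this
  obtain ⟨g, hg, t, ht⟩ := Fintype.not_linearIndependent_iff.mp hdep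
  -- pair the relation with each `P m`
  have hrel : ∀ w : Fin 3 → F,
      g 0 * (L a ⬝ᵥ w) + g 1 * (L b ⬝ᵥ w) + g 2 * (L i ⬝ᵥ w) + g 3 * (L j ⬝ᵥ w) = 0 := by
    intro w
    have := congrArg (fun u => u ⬝ᵥ w) hg
    simpa [Fin.sum_univ_four, v, add_dotProduct, smul_dotProduct] using this
  have ea := hrel (P a)
  have eb := hrel (P b)
  have ei := hrel (P i)
  have ej := hrel (P j)
  rw [h0 a, hskew a b, hskew a i, hskew a j] at ea
  rw [h0 b, hskew b i, hskew b j] at eb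
  rw [h0 i, hskew i j] at ei
  rw [h0 j] at ej
  -- `g t · Pf = 0` for each `t`, and some `g t ≠ 0`
  set x := L a ⬝ᵥ P b
  set y := L a ⬝ᵥ P i
  set z := L a ⬝ᵥ P j
  set u := L b ⬝ᵥ P i
  set w := L b ⬝ᵥ P j
  set r := L i ⬝ᵥ P j
  have k0 : g 0 * (x * r - y * w + z * u) = 0 := by linear_combination r * eb - w * ei + u * ej
  have k1 : g 1 * (x * r - y * w + z * u) = 0 := by linear_combination (-r) * ea + z * ei - y * ej
  have k2 : g 2 * (x * r - y * w + z * u) = 0 := by linear_combination w * ea - z * eb + x * ej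
  have k3 : g 3 * (x * r - y * w + z * u) = 0 := by linear_combination (-u) * ea + y * eb - x * ei
  fin_cases t
  · exact (mul_eq_zero.mp k0).resolve_left ht
  · exact (mul_eq_zero.mp k1).resolve_left ht
  · exact (mul_eq_zero.mp k2).resolve_left ht
  · exact (mul_eq_zero.mp k3).resolve_left ht

variable [Fintype ι] [DecidableEq ι]

/-- **Door D9, the skew rule.**  A square matrix of rank `≤ 3` over a finite field `F` with zero
diagonal, nowhere-zero off-diagonal and `E_ji = −E_ij` has at most `|F| + 3` rows: by the Pfaffian
relation `E_ab·E_ij = E_ai·E_bj − E_aj·E_bi` (`pfaffian_eq_zero`) the rows `i ∉ {a,b}` give pairwise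
non-proportional vectors `(E_ai : E_bi)` of the projective line (`≤ |F| + 1` of them).  Sharp up to
the additive constant: `E_ij = x_i − x_j` with distinct `x_i` has `|F|` rows.  [elementary] -/
theorem card_le_of_skew_rule [Fintype F] [DecidableEq F] (E : Matrix ι ι F) (hE : E.rank ≤ 3)
    (h0 : ∀ i, E i i = 0) (h1 : ∀ i j, i ≠ j → E i j ≠ 0) (hskew : ∀ i j, E j i = -E i j) :
    Fintype.card ι ≤ Fintype.card F + 3 := by
  classical
  by_cases hsmall : Fintype.card ι ≤ 2
  · omega
  push Not at hsmall
  obtain ⟨a, b, hab⟩ := Fintype.exists_pair_of_one_lt_card (by omega : 1 < Fintype.card ι)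
  obtain ⟨L, P, hLP⟩ := HermitianUnital.exists_dotProduct_eq_of_rank_le_three E hE
  have h0' : ∀ i, L i ⬝ᵥ P i = 0 := fun i => by rw [hLP]; exact h0 i
  have hskew' : ∀ i j, L j ⬝ᵥ P i = -(L i ⬝ᵥ P j) := fun i j => by rw [hLP, hLP]; exact hskew i j
  have hpf : ∀ i j, E a b * E i j = E a i * E b j - E a j * E b i := by
    intro i j
    have := pfaffian_eq_zero L P h0' hskew' a b i j
    simp only [hLP] at this
    linear_combination this
  -- the slope map on the rows other than `a`, `b`
  let T := {i : ι // ¬(i = a ∨ i = b)}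
  let slope : T → Option F := fun i => if E b i = 0 then none else some (E a i / E b i)
  have hinj : Function.Injective slope := by
    rintro ⟨i, hi⟩ ⟨j, hj⟩ hs
    by_contra hne
    have hne' : i ≠ j := fun h => hne (Subtype.ext h)
    have hprop : E a i * E b j = E a j * E b i := by
      simp only [slope] at hs
      by_cases hi : E b i = 0 <;> by_cases hj : E b j = 0
      · rw [hi, hj]; ring
      · simp [hi, hj] at hs
      · simp [hi, hj] at hs
      · simp only [hi, hj, ↓reduceIte, Option.some.injEq] at hs
        rw [div_eq_div_iff hi hj] at hs
        linear_combination hs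
    have hzero : E a b * E i j = 0 := by rw [hpf]; linear_combination hprop
    rcases mul_eq_zero.mp hzero with h | h
    · exact h1 a b hab h
    · exact h1 i j hne' h
  have hT : Fintype.card T ≤ Fintype.card (Option F) := Fintype.card_le_of_injective slope hinj
  rw [Fintype.card_option] at hT
  -- `|ι| = |T| + 2`
  have h2 : Fintype.card {i : ι // i = a ∨ i = b} = 2 := by
    rw [Fintype.card_subtype]
    have : (Finset.univ.filter fun i : ι => i = a ∨ i = b) = {a, b} := by
      ext i
      simp
    rw [this, Finset.card_pair hab]
  have hTcard : Fintype.card T = Fintype.card ι - Fintype.card {i : ι // i = a ∨ i = b} :=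
    Fintype.card_subtype_compl _
  omega

end SkewRule

section StubFormat

variable {F : Type*} [Field F] [DecidableEq F]

/-- **Stub format, bilinear rules.**  A design `a_f ⬝ b_{f'} = 1 ↔ f = f'` (the stub's normal form)
whose mutual incidences obey one rule
`α·(a_f⬝b_{f'})(a_{f'}⬝b_f) + β·(a_f⬝b_{f'}) + γ·(a_{f'}⬝b_f) + δ = 0` for all `f ≠ f'`, NOT
satisfied by the diagonal value `(1,1)` (i.e. `α + β + γ + δ ≠ 0`), has at most
`16` flags.  (Defect matrix `E = (a_f ⬝ b_{f'} − 1)` of part C + `card_le_of_bilinear_rule`.)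
[elementary] -/
theorem srs_card_le_of_bilinear_rule (S : Finset ((Fin 2 → F) × (Fin 2 → F)))
    (hS : ∀ f ∈ S, ∀ f' ∈ S, (f.1 ⬝ᵥ f'.2 = 1 ↔ f = f')) {α β γ δ : F}
    (hdiag : α + β + γ + δ ≠ 0)
    (hrule : ∀ f ∈ S, ∀ f' ∈ S, f ≠ f' →
      α * ((f.1 ⬝ᵥ f'.2) * (f'.1 ⬝ᵥ f.2)) + β * (f.1 ⬝ᵥ f'.2) + γ * (f'.1 ⬝ᵥ f.2) + δ = 0) :
    S.card ≤ 16 := by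
  classical
  obtain ⟨h0, -, hr⟩ := HermitianUnital.srs_defect_rank_le_three S hS
  set E : Matrix S S F := Matrix.of fun f f' : S => f.1.1 ⬝ᵥ f'.1.2 - 1 with hEdef
  -- the rule in terms of `E = (incidence) − 1`
  have hrule' : ∀ i j : S, i ≠ j →
      α * (E i j * E j i) + (α + β) * E i j + (α + γ) * E j i + (α + β + γ + δ) = 0 := by
    intro i j hij
    have hne : (i : (Fin 2 → F) × (Fin 2 → F)) ≠ j := fun h => hij (Subtype.ext h)
    have := hrule _ i.2 _ j.2 hne
    simp only [hEdef, of_apply]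
    linear_combination this
  have h := card_le_sixteen_of_bilinear_rule E hr h0 hdiag hrule'
  rwa [Fintype.card_coe] at h

/-- Skew rule in stub format: `(a_f⬝b_{f'} − 1) + (a_{f'}⬝b_f − 1) = 0`, i.e.
`a_f⬝b_{f'} + a_{f'}⬝b_f = 2`
for all `f, f'` — the one sum rule not covered above — forces `|S| ≤ |F| + 3`. [elementary] -/
theorem srs_card_le_of_skew_rule [Fintype F] (S : Finset ((Fin 2 → F) × (Fin 2 → F)))
    (hS : ∀ f ∈ S, ∀ f' ∈ S, (f.1 ⬝ᵥ f'.2 = 1 ↔ f = f'))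
    (hrule : ∀ f ∈ S, ∀ f' ∈ S, f.1 ⬝ᵥ f'.2 + f'.1 ⬝ᵥ f.2 = 2) :
    S.card ≤ Fintype.card F + 3 := by
  classical
  obtain ⟨h0, h1, hr⟩ := HermitianUnital.srs_defect_rank_le_three S hS
  set E : Matrix S S F := Matrix.of fun f f' : S => f.1.1 ⬝ᵥ f'.1.2 - 1 with hEdef
  have hskew : ∀ i j : S, E j i = -E i j := by
    intro i j
    have := hrule _ i.2 _ j.2
    simp only [hEdef, of_apply]
    linear_combination this
  have h := card_le_of_skew_rule E hr h0 h1 hskew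
  rwa [Fintype.card_coe] at h

/-- **The rule-conjugate form of `stub_tangencySets` is false.**  No `c > 0` admits, for every `p₀`,
a prime `p ≥ p₀` and a design in the stub's format of size `≥ c·p^{3/2}` whose mutual incidences
obey a bilinear conjugation rule not satisfied at the diagonal value: such designs have `≤ 16` flags
for every
`p` (`srs_card_le_of_bilinear_rule`), while `c·p^{3/2} ≥ c·p > 16` for large `p`.  Compare
`BaerPolarity.not_polar_tangencySets` (the symmetric rule, `≤ p+1`). [elementary] -/
theorem not_bilinearRule_tangencySets :
    ¬ ∃ c : ℝ, 0 < c ∧ ∀ p₀ : ℕ, ∃ (p : ℕ) (_ : Fact p.Prime), p₀ ≤ p ∧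
      ∃ (α β γ δ : ZMod p) (S : Finset ((Fin 2 → ZMod p) × (Fin 2 → ZMod p))),
        α + β + γ + δ ≠ 0 ∧ c * (p : ℝ) ^ (3 / 2 : ℝ) ≤ S.card ∧
        (∀ f ∈ S, ∀ f' ∈ S, (dotProduct f.1 f'.2 = 1 ↔ f = f')) ∧
        (∀ f ∈ S, ∀ f' ∈ S, f ≠ f' → α * (dotProduct f.1 f'.2 * dotProduct f'.1 f.2) +
          β * dotProduct f.1 f'.2 + γ * dotProduct f'.1 f.2 + δ = 0) := by
  rintro ⟨c, hc, h⟩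
  obtain ⟨p, hp, hp₀, α, β, γ, δ, S, hdiag, hcard, hS, hrule⟩ := h (Nat.ceil (16 / c) + 1)
  have hSle : (S.card : ℝ) ≤ 16 := by
    exact_mod_cast srs_card_le_of_bilinear_rule S hS hdiag hrule
  have hp1 : (1 : ℝ) ≤ p := by exact_mod_cast hp.out.one_le
  have hp0 : (0 : ℝ) < p := by linarith
  -- `p ≤ p^{3/2}`
  have hpow : (p : ℝ) ≤ (p : ℝ) ^ (3 / 2 : ℝ) := by
    calc (p : ℝ) = (p : ℝ) ^ (1 : ℝ) := (Real.rpow_one _).symm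
      _ ≤ (p : ℝ) ^ (3 / 2 : ℝ) := Real.rpow_le_rpow_of_exponent_le hp1 (by norm_num)
  have h1 : c * p ≤ 16 := by nlinarith [mul_le_mul_of_nonneg_left hpow hc.le]
  have h2 : (p : ℝ) ≤ 16 / c := by
    rw [le_div_iff₀ hc]; linarith [mul_comm c (p : ℝ)]
  have h3 : (p : ℝ) ≤ Nat.ceil (16 / c) := h2.trans (Nat.le_ceil _)
  have h4 : (Nat.ceil (16 / c) + 1 : ℝ) ≤ p := by exact_mod_cast hp₀
  linarith

end StubFormat

end Summit.MatrixMultiplication.MatrixMultiplication.Theorems.LevelOneGL2Designs.ConjugationRules
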